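import Literature.Barriers.SmoothPoincare4.ExoticOpenFourSpace
import Literature.Topology.FourManifolds.ImmersionCriterion
import Mathlib.Geometry.Manifold.SmoothEmbedding
import Mathlib.Geometry.Manifold.Instances.Sphere
import HarnessLib

/-!
# Narrowed barrier (audit of `OpenAnalogueBarrierFour`, 2026-08-16): the exotic-open-`ℝ⁴` barrier is END-BLIND — interiors of smooth 3-spheres in `ℝ⁴` are standard (Huebsch–Morse 1962)

Barrier catalogue `Literature/Barriers/SmoothPoincare4/` (D-0021), companion of
`ExoticOpenFourSpace.lean` (entry A14, `Literature.Barriers.SmoothPoincare4.OpenAnalogueBarrierFour`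
`= ¬ OpenSubsetUniquenessFour`: some open subset of `ℝ⁴` homeomorphic to `ℝ⁴` is not diffeomorphic
to `ℝ⁴` — Casson–Freedman's small exotic `ℝ⁴`, DeMichelis–Freedman's ribbon `ℝ⁴`'s; a theorem
relative to the tree fact spc4.S11). The barrier STATEMENT is correct. The audit (refuter,
barrier-audit mode, 2026-08-16) found its catalogued TECHNIQUE CLASS too broad in one precise,
formalisable respect, and one sentence of its framing wrong in the opposite direction.

## 1. What the block claims to kill, and why that inference is in fact a theorem

The BARRIER block of `OpenAnalogueBarrierFour` names as the prototype of the blocked class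
"concluding `Σ ∖ {p} ≅ ℝ⁴` for a homotopy 4-sphere `Σ` … once `Σ ∖ {p}` is smoothly embedded in
`ℝ⁴` (cf. crux (A) '`Σ ∖ {p}` embeds in `ℝ⁴`' of route `SchoenfliesSplit`)", and the catalogue
index (`BARRIERS.lean`, A14) records "Kills: any inference '`Σ ∖ {p}` smoothly embeds in `ℝ⁴` ⇒
standard'". That inference is VALID — it is sixty-year-old Schoenflies theory:

* **Huebsch–Morse.** "THEOREM 3.1. If `M` is the image of `S` in `E` under a `C¹`-diffeomorphism
  `f`, the interior of `M` is an open analytic `n`-ball" — `E = Eⁿ` euclidean `n`-space, `n > 1`,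
  `S` its unit `(n-1)`-sphere, "interior" = the bounded complementary domain `J̊M` ("the unique,
  bounded, maximal connected subset of `ℰ` which does not meet `𝔐`", Morse 1960), "open analytic
  `n`-ball" = "the image of an open `n`-ball in `E` under an analytic diffeomorphism"; EVERY `n`,
  in particular `n = 4` [cite: MorseSchoenfliesProblems1962, §3 Thm. 3.1 (p. 325)]; proof in
  [cite: HuebschMorse1962, Introduction and main theorem]. (Already Morse 1959: the Schoenflies
  extension of a smooth sphere is a homeomorphism of the closed ball onto the closed interior
  region which is a `C^m`-diffeomorphism off ONE point — "THEOREM 2.1. A `C^m`-diffeomorphism `f`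
  of `S` into `E`, `m > 0`, can be extended by a `C₀^m`-diffeomorphism `F` of `JS` onto `Jf(S)`"
  [cite: MorseSchoenfliesProblems1962, §2 Thm. 2.1] [cite: MorseSchoenfliesReduction1960, Thm. 1 (ii)]
  [cite: MorseSchoenfliesCompositio1959, main theorem].)
* **Mazur–Stallings (the same by the infinite product technique).** "THEOREM 2: Let `(M; A, B)`
  be an invertible cobordism. Then `M - B` is equivalent [diffeomorphic] to `A × [0, 1)`", all
  dimensions [cite: StallingsInfiniteProcesses1965, §2 Thm. 2 (p. 250)] [cite: Mazur1959, §2].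

Consequently, for a homotopy 4-sphere `Σ` and `p ∈ Σ` the following are EQUIVALENT:
(A) `Σ ∖ {p}` embeds smoothly in `ℝ⁴`; (A') `Σ` is invertible (`Σ # Σ' ≅ S⁴` for some `Σ'`);
(A'') `Σ ∖ {p}` is DIFFEOMORPHIC to `ℝ⁴`. Proof of (A) ⇒ (A''): with `ι : Σ ∖ {p} ↪ ℝ⁴` and a
closed chart ball `B ∋ p`, `W := Σ ∖ int B` is compact with boundary the smooth 3-sphere `∂B`, so
`ι(int W)` — open, connected, bounded, closed in `ℝ⁴ ∖ ι(∂B)` — is the bounded complementary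
domain of the smooth 3-sphere `T := ι(∂B) ⊂ ℝ⁴`; by Thm. 3.1, `int W ≅ J̊T ≅ ℝ⁴`; and
`Σ ∖ {p} ≅ Σ ∖ B = int W` (radial reparametrisation in the chart). [Equivalently: `Σ` twice
punctured is an invertible cobordism from `S³` to `S³` when `Σ # Σ' ≅ S⁴`, and Stallings' Thm. 2
gives `Σ ∖ (B ⊔ {q}) ≅ S³ × [0,1)`, whence `Σ ∖ {q} ≅ D⁴ ∪ S³ × [0,1) ≅ ℝ⁴`.]

So the witnesses of A14 — exotic open subsets `U ⊂ ℝ⁴`, `U ≈ ℝ⁴` — are NEVER of the form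
`Σ ∖ {p}`, never interiors of smooth 3-spheres, never carry a smooth closed collar `S³ × [0, ∞)`
of their end: the barrier blocks exactly the END-BLIND arguments (those using only "homeomorphic
to `ℝ⁴`" + "open in `ℝ⁴`/`S⁴`"), and nothing that uses the standard `S³ × ℝ` end of a punctured
homotopy sphere. Route `SchoenfliesSplit` already evades it correctly ("the embedding of `Σ ∖ p`
is used only through the COMPACT piece"), but records "(A)'s end theory (`Σ ∖ p ≅ ℝ⁴`?)" as
undecomposed — by the above it is decided: (A) ⇔ (A'').

## 2. The framing sentence that errs the other way

The file docstring of `ExoticOpenFourSpace.lean` says "… conclude '`Σ ∖ {p} ≅ ℝ⁴`' (and hence,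
via Cerf, `Σ ≅ S⁴`)". The implication `Σ ∖ {p} ≅ ℝ⁴ ⇒ Σ ≅ S⁴` is NOT Cerf's theorem and is not
known: writing `Σ = φ(D_R) ∪ N` with `N ∖ {p} ≅ S³ × [0, 1)`, "`N ≅ D⁴`" is an instance of the
smooth 4-dimensional Schoenflies problem (`N ⊂` a chart ball `⊂ S⁴`), and conversely the smooth
Schoenflies conjecture (tree: `Literature.Topology.FourManifolds.SmoothSchoenfliesConjectureFour`,
registered OPEN) follows from that implication applied to `Σ_A := A ∪_∂ D⁴`, `A` a Schoenflies
ball, via Thm. 3.1 (`Σ_A ∖ {centre} ≅ int A ≅ ℝ⁴`) and Palais' disc theorem. Cerf's `Γ₄ = 0`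
enters only AFTER a ball complement is known to be a ball. Net (FGMW 2010, p. 3 fn.: Schoenflies
"asks if there are invertible homotopy spheres"): `SPC4 ⇔ (A) ∧ [smooth Schoenflies]`, and by §1
an invertible homotopy sphere is ALREADY standard off one point — `Σ ∖ {p} ≅ ℝ⁴`, i.e. a
homeomorphism `Σ → S⁴` which is a diffeomorphism except at `p`; what remains is the removability
of a one-point differential singularity (Morse's "closed cell problem", `4 ∈ τ`?,
[cite: MorseSchoenfliesProblems1962, §3 Lemma 3.2]). [cite: FreedmanGompfMorrisonWalker2010, §1 p. 3 footnote]

## 3. What this file records (one named fact, D-0026; everything else proved)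

* `IsSmoothSphereInterior n U` — DEFINITION (predicate with body): the open set
  `U ⊆ ℝⁿ⁺¹` is a bounded connected component of the complement of a smoothly embedded round
  `n`-sphere `f(Sⁿ)` (`Manifold.IsSmoothEmbedding`), i.e. Morse's interior `J̊M`, `M = f(S)`
  (for `n + 1 ≥ 2` the complement has exactly one bounded component — Jordan–Brouwer, tree
  `SchoenfliesSeparation.lean` — so "a bounded component" is "the interior").
* `huebschMorse1962_sphereInterior` — NAMED FACT (Huebsch–Morse 1962 = Morse's Thm. 3.1), for
  every `n ≥ 1`: such a `U` is `C^∞`-diffeomorphic to `ℝⁿ⁺¹` (printed: real-analytically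
  diffeomorphic to the open unit ball, which is diffeomorphic to `ℝⁿ⁺¹` — Mathlib's
  `OpenPartialHomeomorph.univUnitBall`; we keep the weaker `C^∞`/`ℝⁿ⁺¹` form, and the smaller
  hypothesis class `C^∞` embeddings ⊂ `C¹` ones).
* PROVED: `isSmoothEmbedding_subtypeVal_sphere` (the round sphere `Sⁿ ⊂ ℝⁿ⁺¹` is a smooth
  embedding), `connectedComponentIn_compl_sphere_zero` (the component of `0` in `ℝⁿ⁺¹ ∖ Sⁿ` is the
  open unit ball), `isSmoothSphereInterior_ball` (NON-VACUITY of the predicate: the unit ball is a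
  smooth-sphere interior); and the narrowed barrier `openAnalogueBarrierFour_narrow`: relative to
  spc4.S11 and the fact, `OpenAnalogueBarrierFour` holds AND every exotic open `ℝ⁴`-homeomorph in
  `ℝ⁴` fails to be a smooth-sphere interior (`not_isSmoothSphereInterior_of_isEmpty_diffeomorph`),
  while the master statement HOLDS on smooth-sphere interiors
  (`openSubsetUniquenessFour_of_isSmoothSphereInterior`).

BARRIER (D-0021) — sharpened lines for A14 (supersede the corresponding lines of
`OpenAnalogueBarrierFour`; the statement `¬ OpenSubsetUniquenessFour` is unchanged):
* technique_class: END-BLIND uniqueness arguments for open `ℝ⁴`-homeomorphs — deriving `U ≅ ℝ⁴` for an open `U ⊆ ℝ⁴`/`S⁴`/any smooth 4-manifold from `U ≈ ℝ⁴` and the ambient smooth structure alone, with no hypothesis on the END of `U` [cite: Kirby1989, Ch. XIV p. 95 and Thm. 3] [cite: DeMichelisFreedman1992, Thm. 4.1].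
* blocks: the master statement `OpenSubsetUniquenessFour` and every detector "`Σ` contains an exotic open `ℝ⁴` ⇒ `Σ ≇ S⁴`" (unchanged) [cite: Kirby1989, Ch. XIV Thm. 3]; NOT the inference "`Σ ∖ {p}` embeds in `ℝ⁴` ⇒ `Σ ∖ {p} ≅ ℝ⁴`", which is a theorem [cite: MorseSchoenfliesProblems1962, §3 Thm. 3.1] [cite: StallingsInfiniteProcesses1965, §2 Thm. 2].
* evasions_known: (i) any use of the standard end — a smooth `S³` cross-section bounding the compact side: interiors of smooth 3-spheres in `ℝ⁴` are standard [cite: MorseSchoenfliesProblems1962, §3 Thm. 3.1] [cite: HuebschMorse1962, main theorem]; invertible-cobordism ends are products [cite: StallingsInfiniteProcesses1965, §2 Thm. 2]; hence punctured INVERTIBLE homotopy 4-spheres are diffeomorphic to `ℝ⁴` and the exotic `U`'s of A14 have no smooth `S³ × [0,∞)` end collar; (ii) compactness-sensitive arguments (unchanged); (iii) the residual problem for invertible `Σ` is the one-point differential singularity = smooth 4D Schoenflies [cite: MorseSchoenfliesProblems1962, §3 Lemma 3.2] [cite: FreedmanGompfMorrisonWalker2010, §1 p. 3 footnote].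
* scope_caveats: (a) "`Σ ∖ {p} ≅ ℝ⁴ ⇒ Σ ≅ S⁴`" is NOT a consequence of Cerf's `Γ₄ = 0`; it is equivalent to the smooth 4-dimensional Schoenflies conjecture (open; tree `SmoothSchoenfliesConjectureFour`) [cite: FreedmanGompfMorrisonWalker2010, §1 p. 3 footnote] [cite: Kirby1989, Ch. I p. 14]; (b) the fact below is Thm. 3.1 for `C^∞` embeddings with conclusion weakened from "analytic ball" to "`C^∞`-diffeomorphic to `ℝⁿ⁺¹`" [cite: MorseSchoenfliesProblems1962, §3 Thm. 3.1].
* status: barrier established (unchanged, rel. spc4.S11); narrowing established in print (Huebsch–Morse 1962, Stallings 1965), vendored as the named fact `huebschMorse1962_sphereInterior` (not discharged: the printed proofs are Morse's explicit Schoenflies extension resp. the infinite product technique, both far from Mathlib) [cite: HuebschMorse1962, main theorem] [cite: StallingsInfiniteProcesses1965, §2 Thm. 2].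

## References

* M. Morse, *Schoenflies problems*, Fund. Math. 50 (1962) 319–332: §2 Thm. 2.1, Thm. 2.2; §3
  Thm. 3.1, Lemma 3.2 [MorseSchoenfliesProblems1962].
* W. Huebsch, M. Morse, *Schoenflies extensions without interior differential singularities*,
  Ann. of Math. 76 (1962) 18–54 [HuebschMorse1962].
* M. Morse, *Differentiable mappings in the Schoenflies theorem*, Compositio Math. 14 (1959)
  83–151 [MorseSchoenfliesCompositio1959]; *A reduction of the Schoenflies extension problem*,
  Bull. AMS 66 (1960) 113–115, Thm. 1 [MorseSchoenfliesReduction1960].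
* J. R. Stallings, *On infinite processes leading to differentiability in the complement of a
  point*, in: Differential and Combinatorial Topology (Morse symposium), Princeton 1965, 245–254,
  Thm. 2, Thm. 4 [StallingsInfiniteProcesses1965]; B. Mazur, *On embeddings of spheres*, Bull. AMS
  65 (1959) 59–65 [Mazur1959].
* M. Freedman, R. Gompf, S. Morrison, K. Walker, Quantum Topol. 1 (2010), p. 3 footnote
  [FreedmanGompfMorrisonWalker2010]; R. Kirby, LNM 1374 (1989), Ch. I p. 14, Ch. XIV [Kirby1989];
  S. DeMichelis, M. Freedman, JDG 35 (1992) [DeMichelisFreedman1992].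
-/

noncomputable section

open scoped Manifold ContDiff Topology
open TopologicalSpace Set Metric Bornology Function

namespace Literature.Barriers.SmoothPoincare4

/-- Local notation: `𝔼 n` is the model Euclidean space `EuclideanSpace ℝ (Fin n)`. -/
local notation "𝔼 " n:arg => EuclideanSpace ℝ (Fin n)

/-- Local notation: `𝕊 n` is the unit sphere in `EuclideanSpace ℝ (Fin (n + 1))`, the standard
`n`-sphere with its Mathlib manifold structure. -/
local notation "𝕊 " n:arg => (Metric.sphere (0 : EuclideanSpace ℝ (Fin (n + 1))) 1)

/-! ### Interiors of smoothly embedded spheres -/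

/-- **Interior of a smooth `n`-sphere in `ℝⁿ⁺¹`** (Morse's `J̊M`, `M = f(S)`), as a predicate on
open subsets: `U ⊆ ℝⁿ⁺¹` is a BOUNDED connected component of the complement of the image of a
smooth embedding `f : Sⁿ ↪ ℝⁿ⁺¹` of the round sphere (`Manifold.IsSmoothEmbedding`, `C^∞`) — the
component of some point `x ∉ f(Sⁿ)` ("`JM` is the unique, bounded, maximal connected subset of `ℰ`
which does not meet `𝔐`"). Definition with body; no fact.
[cite: MorseSchoenfliesReduction1960, §1 (definition of the interior J𝔐)] -/
def IsSmoothSphereInterior (n : ℕ) (U : Opens (𝔼 (n + 1))) : Prop :=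
  ∃ (f : 𝕊 n → 𝔼 (n + 1)) (x : 𝔼 (n + 1)),
    Manifold.IsSmoothEmbedding (𝓡 n) (𝓡 (n + 1)) ∞ f ∧ x ∉ range f ∧
      IsBounded (U : Set (𝔼 (n + 1))) ∧ (U : Set (𝔼 (n + 1))) = connectedComponentIn (range f)ᶜ x

/-- **Huebsch–Morse 1962 (Morse, *Schoenflies problems*, Thm. 3.1; named fact).** "If `M` is the
image of `S` in `E` under a `C¹`-diffeomorphism `f`, the interior of `M` is an open analytic
`n`-ball": for every `n ≥ 1`, every bounded complementary domain `U` of a smoothly embedded round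
`n`-sphere in `ℝⁿ⁺¹` is diffeomorphic to `ℝⁿ⁺¹` (printed: real-analytically diffeomorphic to the
open unit ball — here weakened to a `C^∞` diffeomorphism onto `ℝⁿ⁺¹ ≅` the ball, and stated for
`C^∞` embeddings only). A THEOREM in print, valid in EVERY dimension, in particular for
smooth 3-spheres in `ℝ⁴` — where, by contrast, whether the CLOSED region is a smooth ball is the
unsettled smooth 4-dimensional Schoenflies question. The same conclusion follows from Stallings'
Thm. 2 (an invertible cobordism minus one end is a product). Users take
`(h : huebschMorse1962_sphereInterior)`.
[cite: MorseSchoenfliesProblems1962, §3 Thm. 3.1 (p. 325)] [cite: HuebschMorse1962, main theorem]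
[cite: StallingsInfiniteProcesses1965, §2 Thm. 2 (p. 250)] -/
def huebschMorse1962_sphereInterior : Prop :=
  ∀ n : ℕ, 1 ≤ n → ∀ U : Opens (𝔼 (n + 1)), IsSmoothSphereInterior n U →
    Nonempty (U ≃ₘ⟮𝓡 (n + 1), 𝓡 (n + 1)⟯ 𝔼 (n + 1))

/-! ### Non-vacuity: the round unit ball is a smooth-sphere interior -/

/-- **The round sphere `Sⁿ ⊂ ℝⁿ⁺¹` is a smooth embedding** (`Manifold.IsSmoothEmbedding`): the
inclusion is `C^∞` (`contMDiff_coe_sphere`), injective, with injective differential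
(`mfderiv_coe_sphere_injective`), on a compact manifold — the tree's immersion criterion
`Literature.Topology.FourManifolds.isSmoothEmbedding_of_injective_of_injective_mfderiv`. [folklore] -/
theorem isSmoothEmbedding_subtypeVal_sphere (n : ℕ) :
    Manifold.IsSmoothEmbedding (𝓡 n) (𝓡 (n + 1)) ∞ (Subtype.val : 𝕊 n → 𝔼 (n + 1)) := by
  haveI : Fact (Module.finrank ℝ (𝔼 (n + 1)) = n + 1) := ⟨finrank_euclideanSpace_fin⟩
  exact Literature.Topology.FourManifolds.isSmoothEmbedding_of_injective_of_injective_mfderiv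
    contMDiff_coe_sphere (by exact_mod_cast le_top) Subtype.val_injective
    (fun v => mfderiv_coe_sphere_injective (n := n) v)

/-- **The connected component of the origin in `ℝⁿ⁺¹ ∖ Sⁿ` is the open unit ball**: the ball is
connected, contains `0` and misses the sphere; conversely a connected subset of the complement of
the sphere containing `0` cannot contain a point of norm `≥ 1` (intermediate value theorem for the
norm). [folklore] -/
theorem connectedComponentIn_compl_sphere_zero (n : ℕ) :
    connectedComponentIn (sphere (0 : 𝔼 (n + 1)) 1)ᶜ 0 = ball (0 : 𝔼 (n + 1)) 1 := by
  apply Subset.antisymm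
  · intro y hy
    by_contra hyb
    have hy1 : 1 ≤ ‖y‖ := by
      simpa [mem_ball_zero_iff] using hyb
    have hpre : IsPreconnected (connectedComponentIn (sphere (0 : 𝔼 (n + 1)) 1)ᶜ 0) :=
      isPreconnected_connectedComponentIn
    have h0 : (0 : 𝔼 (n + 1)) ∈ connectedComponentIn (sphere (0 : 𝔼 (n + 1)) 1)ᶜ 0 :=
      mem_connectedComponentIn (by simp)
    have hIcc := hpre.intermediate_value h0 hy continuous_norm.continuousOn
    have h1mem : (1 : ℝ) ∈ Icc ‖(0 : 𝔼 (n + 1))‖ ‖y‖ := ⟨by simp, hy1⟩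
    obtain ⟨z, hz, hz1⟩ := hIcc h1mem
    have hzs : z ∈ sphere (0 : 𝔼 (n + 1)) 1 := mem_sphere_zero_iff_norm.mpr hz1
    exact connectedComponentIn_subset _ _ hz hzs
  · refine (convex_ball (0 : 𝔼 (n + 1)) 1).isPreconnected.subset_connectedComponentIn
      (mem_ball_self one_pos) ?_
    intro y hy hys
    have h1 : ‖y‖ = 1 := mem_sphere_zero_iff_norm.mp hys
    have h2 : ‖y‖ < 1 := mem_ball_zero_iff.mp hy
    exact absurd h1 h2.ne

/-- **Non-vacuity of `IsSmoothSphereInterior`**: the open unit ball of `ℝⁿ⁺¹` is the interior of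
the smoothly embedded round sphere `Sⁿ` (witnesses `f = Subtype.val`, `x = 0`). [folklore] -/
theorem isSmoothSphereInterior_ball (n : ℕ) :
    IsSmoothSphereInterior n ⟨ball (0 : 𝔼 (n + 1)) 1, isOpen_ball⟩ := by
  refine ⟨Subtype.val, 0, isSmoothEmbedding_subtypeVal_sphere n, ?_, isBounded_ball, ?_⟩
  · rw [Subtype.range_coe]
    simp
  · rw [Subtype.range_coe]
    exact (connectedComponentIn_compl_sphere_zero n).symm

/-! ### The narrowed barrier: A14 holds, and its witnesses are never smooth-sphere interiors -/

/-- **The master statement HOLDS on smooth-sphere interiors** (the end-collared sub-class of the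
technique class of A14): relative to the Huebsch–Morse fact, every open subset of `ℝ⁴` which is
the interior of a smoothly embedded `S³` is diffeomorphic to `ℝ⁴` — whereas
`OpenSubsetUniquenessFour` (all `ℝ⁴`-homeomorphs) is false (`openAnalogueBarrierFour_of_exoticR4`).
[cite: MorseSchoenfliesProblems1962, §3 Thm. 3.1 (p. 325)] -/
theorem openSubsetUniquenessFour_of_isSmoothSphereInterior (hHM : huebschMorse1962_sphereInterior)
    (U : Opens (𝔼 4)) (hU : IsSmoothSphereInterior 3 U) : Nonempty (U ≃ₘ⟮𝓡 4, 𝓡 4⟯ 𝔼 4) :=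
  hHM 3 (by norm_num) U hU

/-- **The exotic open `ℝ⁴`-homeomorphs of A14 are never interiors of smooth 3-spheres** (the
barrier is end-blind): an open `U ⊆ ℝ⁴` not diffeomorphic to `ℝ⁴` is not the bounded
complementary domain of any smoothly embedded `S³ ⊂ ℝ⁴`; in particular it is not `ι(Σ ∖ B)` for
a punctured homotopy 4-sphere embedded in `ℝ⁴`, and carries no smooth `S³` cross-section bounding
its compact side. [cite: MorseSchoenfliesProblems1962, §3 Thm. 3.1 (p. 325)]
[cite: StallingsInfiniteProcesses1965, §2 Thm. 2 (p. 250)] -/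
theorem not_isSmoothSphereInterior_of_isEmpty_diffeomorph (hHM : huebschMorse1962_sphereInterior)
    {U : Opens (𝔼 4)} (hU : IsEmpty (U ≃ₘ⟮𝓡 4, 𝓡 4⟯ 𝔼 4)) : ¬ IsSmoothSphereInterior 3 U :=
  fun h => by
    obtain ⟨e⟩ := openSubsetUniquenessFour_of_isSmoothSphereInterior hHM U h
    exact hU.false e

/-- **Narrowed barrier A14** (relative to the tree fact spc4.S11 and the Huebsch–Morse fact): the
open analogue of `SmoothPoincare4` fails inside standard 4-space (`OpenAnalogueBarrierFour`), and
EVERY witness of that failure — an open `U ⊆ ℝ⁴` homeomorphic but not diffeomorphic to `ℝ⁴` —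
lies outside the end-collared sub-class: it is not the interior of any smooth `S³ ⊂ ℝ⁴`. Hence the
barrier does not touch arguments about punctured homotopy spheres that use their standard end
(for which "embeds in `ℝ⁴` ⇒ diffeomorphic to `ℝ⁴`" is a theorem).
[cite: Kirby1989, Ch. XIV Thm. 3] [cite: MorseSchoenfliesProblems1962, §3 Thm. 3.1 (p. 325)] -/
theorem openAnalogueBarrierFour_narrow
    (hR : Literature.Topology.FourManifolds.exists_opens_nonempty_homeomorph_isEmpty_diffeomorph_euclideanSpace_four)
    (hHM : huebschMorse1962_sphereInterior) :
    OpenAnalogueBarrierFour ∧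
      (∀ U : Opens (𝔼 4), IsEmpty (U ≃ₘ⟮𝓡 4, 𝓡 4⟯ 𝔼 4) → ¬ IsSmoothSphereInterior 3 U) ∧
      ∃ U : Opens (𝔼 4), Nonempty (U ≃ₜ 𝔼 4) ∧ IsEmpty (U ≃ₘ⟮𝓡 4, 𝓡 4⟯ 𝔼 4) ∧
        ¬ IsSmoothSphereInterior 3 U := by
  refine ⟨openAnalogueBarrierFour_of_exoticR4 hR,
    fun U hU => not_isSmoothSphereInterior_of_isEmpty_diffeomorph hHM hU, ?_⟩
  obtain ⟨U, hU, hE⟩ := hR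
  exact ⟨U, hU, hE, not_isSmoothSphereInterior_of_isEmpty_diffeomorph hHM hE⟩

end Literature.Barriers.SmoothPoincare4

end
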